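import Summits.Ventures.PercRepro.HyperplaneKeyUniformSharp
import Summits.Ventures.PercRepro.S2DirectCell

/-!
# PercRepro — THE SIZE KEY AT EVERY LEVEL, MONOTONE IN `n`: ONE BASE VALUE PER ROW CLOSES THE WHOLE TAIL (p1, gen 44;
an S3 / S4 feeder — p8 owns SUBCLAIM-S3, p9 SUBCLAIM-S4; no window claim here)

THE SIZE KEY (p7's `c025_core_five_cell_key` at level `5`, per cell): every set of `q+1 … p−1` points has rank `< p`, so it is in
`Y(p, q)` unless its rank is `≤ q`; with `#U ≤ #{ρ ≤ q} ≤ A(n)`: **`(Φ(p,q) + 1)·A(n) ≤ Σ_{q<s<p} C(n, s)` gives `RLS M p q`**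
(`rls_of_size_key`; `choose_sum_Ioo_le_midCount_add` is the level-`q` form of p7's `choose_sum_six_le_midCount_add`).
THE MONOTONICITY: for `n ≥ q + 1` the ratio `C(n+1, k)/C(n, k) = (n+1)/(n+1−k)` is increasing in `k`, so with `r = (n+1)/(n−q)`
every layer `s ≥ q + 1` of the right side grows by `≥ r` while every layer `j ≤ q` of the cap grows by `≤ r`
(`choose_succ_le_mul`, `mul_le_choose_succ`): the key at `n` implies the key at `n + 1` (`size_key_step`), hence ONE base value
`n₀` per row closes every `n ≥ n₀` (`size_key_of_base`, `rls_of_size_key_of_base` — the base value may be checked on any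
sub-range `a … b` of the layers). `phiK_eq_two_pow_sub` evaluates `Φ(p, q) = (2^{p+q} − 2Σ_{u≤q} C(p+q, u))/C(p+q, p)` from
`q + 1` binomials. Where it stands against the hyperplane key (exact rationals, tools/price_size.py): at level `7` the size key
wins from `p = 25` on (`n₀ = 184 / 141 / 119 / 119 / 124 / 142 / 165` at `p = 25 / 30 / 40 / 50 / 60 / 80 / 104` against the
ladder's `204 / 214 / 226 / 246 / 262 / 298 / 346`), at level `8` from `p = 45` on (`389 / 330 / 274 / 243 / 245 / 265 / 293 / 323`
at `p = 45 / 50 / 60 / 80 / 100 / 130 / 160 / 191` against `392 / 402 / 416 / 450 / 490 / 544 / 602 / 664`); the per-row instances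
are in `HyperplaneKeySizeRows*`. Coloops are not excluded; nothing is claimed below the thresholds.
Axioms: standard.
-/

open scoped Matroid

namespace PercRepro

namespace HypKey

open Set

variable {α : Type}

/-- `Finset.Ioo q p = Finset.Ico (q + 1) p` in `ℕ`. -/
theorem Ioo_eq_Ico_succ (q p : ℕ) : Finset.Ioo q p = Finset.Ico (q + 1) p := by
  ext u
  simp only [Finset.mem_Ioo, Finset.mem_Ico]
  omega

/-- **`Φ(p, q)` from `q + 1` binomials**: `Σ_{q<u<p} C(p+q, u) = 2^{p+q} − 2·Σ_{u≤q} C(p+q, u)` for `q + 1 ≤ p`. -/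
theorem sum_Ioo_choose_eq (p q : ℕ) (hqp : q + 1 ≤ p) :
    ((∑ u ∈ Finset.Ioo q p, (p + q).choose u : ℕ) : ℚ) =
      (2 : ℚ) ^ (p + q) - 2 * ((∑ u ∈ Finset.range (q + 1), (p + q).choose u : ℕ) : ℚ) := by
  have htot : ∑ u ∈ Finset.range (p + q + 1), (p + q).choose u = 2 ^ (p + q) := Nat.sum_range_choose (p + q)
  have hsplit : ∑ u ∈ Finset.range (p + q + 1), (p + q).choose u =
      ∑ u ∈ Finset.range (q + 1), (p + q).choose u + ∑ u ∈ Finset.Ioo q p, (p + q).choose u +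
        ∑ u ∈ Finset.Ico p (p + q + 1), (p + q).choose u := by
    rw [Ioo_eq_Ico_succ, ← Nat.Ico_zero_eq_range, ← Nat.Ico_zero_eq_range,
      Finset.sum_Ico_consecutive _ (Nat.zero_le (q + 1)) hqp,
      Finset.sum_Ico_consecutive _ (Nat.zero_le p) (by omega : p ≤ p + q + 1)]
  have htail : ∑ u ∈ Finset.Ico p (p + q + 1), (p + q).choose u = ∑ u ∈ Finset.range (q + 1), (p + q).choose u := by
    rw [Finset.sum_Ico_eq_sum_range]
    have e : p + q + 1 - p = q + 1 := by omega
    rw [e]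
    rw [← Finset.sum_range_reflect (fun k => (p + q).choose (p + k)) (q + 1)]
    refine Finset.sum_congr rfl (fun k hk => ?_)
    have hk' : k < q + 1 := Finset.mem_range.1 hk
    rw [Nat.choose_symm_of_eq_add]
    omega
  have h : (∑ u ∈ Finset.Ioo q p, (p + q).choose u) + 2 * ∑ u ∈ Finset.range (q + 1), (p + q).choose u = 2 ^ (p + q) := by
    rw [← htot, hsplit, htail]
    ring
  have hq : (((∑ u ∈ Finset.Ioo q p, (p + q).choose u) + 2 * ∑ u ∈ Finset.range (q + 1), (p + q).choose u : ℕ) : ℚ) =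
      ((2 ^ (p + q) : ℕ) : ℚ) := by rw [h]
  push_cast at hq ⊢
  linarith

/-- **`Φ(p, q) = (2^{p+q} − 2Σ_{u≤q} C(p+q, u)) / C(p+q, p)`** for `q + 1 ≤ p`. -/
theorem phiK_eq_two_pow_sub (p q : ℕ) (hqp : q + 1 ≤ p) :
    phiK p q = ((2 : ℚ) ^ (p + q) - 2 * ((∑ u ∈ Finset.range (q + 1), (p + q).choose u : ℕ) : ℚ)) /
      ((p + q).choose p : ℚ) := by
  unfold phiK
  rw [← sum_Ioo_choose_eq p q hqp]
  push_cast
  rfl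

/-- **`Σ_{q<s<p} C(n, s) ≤ #Y(p, q) + #{ρ ≤ q}`** at every level: an `s`-subset with `q < s < p` has rank `< p`; it is in `Y`
unless its rank is `≤ q` (p7's `choose_sum_six_le_midCount_add` at level `5`). -/
theorem choose_sum_Ioo_le_midCount_add (M : Matroid α) [M.Finite] (p q : ℕ) :
    ∑ s ∈ Finset.Ioo q p, M.E.ncard.choose s ≤
      Matroid.midCount M p q + {X : Set α | X ⊆ M.E ∧ M.eRk X ≤ (q : ℕ∞)}.ncard := by
  have hE : (M.ground_finite.toFinset : Set α) = M.E := Set.Finite.coe_toFinset _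
  have hcard : M.ground_finite.toFinset.card = M.E.ncard :=
    (Set.ncard_eq_toFinset_card _ M.ground_finite).symm
  rw [← hcard, ← ThmN.ncard_subsets_ncard_mem M.ground_finite.toFinset (Finset.Ioo q p)]
  unfold Matroid.midCount
  refine le_trans (Set.ncard_le_ncard ?_ ?_) (Set.ncard_union_le _ _)
  · intro X hX
    have hXE : X ⊆ M.E := by rw [← hE]; exact hX.1
    have hXfin : X.Finite := M.ground_finite.subset hXE
    have hXc := Finset.mem_Ioo.1 hX.2
    by_cases hq : M.eRk X ≤ (q : ℕ∞)
    · exact Or.inr ⟨hXE, hq⟩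
    · refine Or.inl ⟨hXE, lt_of_not_ge hq, ?_⟩
      calc M.eRk X ≤ X.encard := M.eRk_le_encard X
        _ = (X.ncard : ℕ∞) := by rw [← hXfin.cast_ncard_eq]
        _ < ((p : ℕ) : ℕ∞) := by exact_mod_cast hXc.2
  · exact (M.ground_finite.finite_subsets.subset (fun X hX => hX.1)).union
      (M.ground_finite.finite_subsets.subset (fun X hX => hX.1))

/-- **THE SIZE KEY.** `#{ρ ≤ q} ≤ A` and `(Φ(p, q) + 1)·A ≤ Σ_{q<s<p} C(n, s)` give `ThmN.RLS M p q` (no hypothesis on the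
rank of `M`). -/
theorem rls_of_size_key (M : Matroid α) [M.Finite] (p q : ℕ)
    (A : ℚ) (hA : ({X : Set α | X ⊆ M.E ∧ M.eRk X ≤ (q : ℕ∞)}.ncard : ℚ) ≤ A)
    (hkey : (phiK p q + 1) * A ≤ ∑ s ∈ Finset.Ioo q p, (M.E.ncard.choose s : ℚ)) : ThmN.RLS M p q := by
  rw [ThmN.RLS_iff]
  have hΦ := phiK_nonneg p q
  have hT := topCount_le_low M p q
  have hY := choose_sum_Ioo_le_midCount_add M p q
  have hTq : (Matroid.topCount M p q : ℚ) ≤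
      ({X : Set α | X ⊆ M.E ∧ M.eRk X ≤ (q : ℕ∞)}.ncard : ℚ) := by exact_mod_cast hT
  have hYq : ∑ s ∈ Finset.Ioo q p, (M.E.ncard.choose s : ℚ) ≤ (Matroid.midCount M p q : ℚ) +
      ({X : Set α | X ⊆ M.E ∧ M.eRk X ≤ (q : ℕ∞)}.ncard : ℚ) := by exact_mod_cast hY
  have h1 : phiK p q * (Matroid.topCount M p q : ℚ) ≤ phiK p q * A :=
    mul_le_mul_of_nonneg_left (hTq.trans hA) hΦ
  nlinarith [h1, hkey, hYq, hA]

/-- **The cap's layers grow by at most `r = (n+1)/(n−q)`**: `C(n+1, j) ≤ C(n, j)·(n+1)/(n−q)` for `j ≤ q < n`. -/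
theorem choose_succ_le_mul (n j q : ℕ) (hj : j ≤ q) (hq : q < n) :
    ((n + 1).choose j : ℚ) ≤ (n.choose j : ℚ) * (((n + 1 : ℕ) : ℚ) / ((n - q : ℕ) : ℚ)) := by
  have h := Nat.choose_mul_succ_eq n j
  have hpos : (0 : ℚ) < ((n - q : ℕ) : ℚ) := by
    have : 0 < n - q := by omega
    exact_mod_cast this
  have hj' : (0 : ℚ) < ((n + 1 - j : ℕ) : ℚ) := by
    have : 0 < n + 1 - j := by omega
    exact_mod_cast this
  have hq' : ((n - q : ℕ) : ℚ) ≤ ((n + 1 - j : ℕ) : ℚ) := by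
    have : n - q ≤ n + 1 - j := by omega
    exact_mod_cast this
  have hqc : ((n.choose j * (n + 1) : ℕ) : ℚ) = (((n + 1).choose j * (n + 1 - j) : ℕ) : ℚ) := by rw [h]
  push_cast at hqc
  rw [mul_div_assoc', le_div_iff₀ hpos]
  have hc : (0 : ℚ) ≤ ((n + 1).choose j : ℚ) := Nat.cast_nonneg _
  calc ((n + 1).choose j : ℚ) * ((n - q : ℕ) : ℚ) ≤ ((n + 1).choose j : ℚ) * ((n + 1 - j : ℕ) : ℚ) :=
        mul_le_mul_of_nonneg_left hq' hc
    _ = (n.choose j : ℚ) * ((n + 1 : ℕ) : ℚ) := by push_cast at hqc ⊢; linarith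

/-- **The `Y` layers grow by at least `r = (n+1)/(n−q)`**: `C(n, s)·(n+1)/(n−q) ≤ C(n+1, s)` for `q < s`, `q < n`. -/
theorem mul_le_choose_succ (n s q : ℕ) (hs : q < s) (hq : q < n) :
    (n.choose s : ℚ) * (((n + 1 : ℕ) : ℚ) / ((n - q : ℕ) : ℚ)) ≤ ((n + 1).choose s : ℚ) := by
  have hpos : (0 : ℚ) < ((n - q : ℕ) : ℚ) := by
    have : 0 < n - q := by omega
    exact_mod_cast this
  rcases Nat.lt_or_ge n s with hns | hns
  · rw [Nat.choose_eq_zero_of_lt hns]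
    simp
  · have h := Nat.choose_mul_succ_eq n s
    have hqc : ((n.choose s * (n + 1) : ℕ) : ℚ) = (((n + 1).choose s * (n + 1 - s) : ℕ) : ℚ) := by rw [h]
    push_cast at hqc
    have hs' : ((n + 1 - s : ℕ) : ℚ) ≤ ((n - q : ℕ) : ℚ) := by
      have : n + 1 - s ≤ n - q := by omega
      exact_mod_cast this
    have hc : (0 : ℚ) ≤ ((n + 1).choose s : ℚ) := Nat.cast_nonneg _
    rw [mul_div_assoc', div_le_iff₀ hpos]
    calc (n.choose s : ℚ) * ((n + 1 : ℕ) : ℚ) = ((n + 1).choose s : ℚ) * ((n + 1 - s : ℕ) : ℚ) := by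
          push_cast at hqc ⊢; linarith
      _ ≤ ((n + 1).choose s : ℚ) * ((n - q : ℕ) : ℚ) := mul_le_mul_of_nonneg_left hs' hc

/-- **THE STEP `n → n + 1`.** For `q < n` and `0 ≤ c`: `c·Σ_{j≤q} C(n, j)·w_j ≤ Σ_{q<s<p} C(n, s)` implies the same at `n + 1`. -/
theorem size_key_step (p q n : ℕ) (w : ℕ → ℕ) (c : ℚ) (hc : 0 ≤ c) (hq : q < n)
    (h : c * ∑ j ∈ Finset.range (q + 1), (n.choose j : ℚ) * (w j : ℚ) ≤ ∑ s ∈ Finset.Ioo q p, (n.choose s : ℚ)) :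
    c * ∑ j ∈ Finset.range (q + 1), ((n + 1).choose j : ℚ) * (w j : ℚ) ≤
      ∑ s ∈ Finset.Ioo q p, ((n + 1).choose s : ℚ) := by
  set r : ℚ := ((n + 1 : ℕ) : ℚ) / ((n - q : ℕ) : ℚ) with hr
  have hr0 : 0 ≤ r := by positivity
  have hA : ∑ j ∈ Finset.range (q + 1), ((n + 1).choose j : ℚ) * (w j : ℚ) ≤
      (∑ j ∈ Finset.range (q + 1), (n.choose j : ℚ) * (w j : ℚ)) * r := by
    rw [Finset.sum_mul]
    refine Finset.sum_le_sum (fun j hj => ?_)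
    have hjq : j ≤ q := by
      have := Finset.mem_range.1 hj
      omega
    have := choose_succ_le_mul n j q hjq hq
    have hw : (0 : ℚ) ≤ (w j : ℚ) := Nat.cast_nonneg _
    calc ((n + 1).choose j : ℚ) * (w j : ℚ) ≤ (n.choose j : ℚ) * r * (w j : ℚ) :=
          mul_le_mul_of_nonneg_right this hw
      _ = (n.choose j : ℚ) * (w j : ℚ) * r := by ring
  have hY : (∑ s ∈ Finset.Ioo q p, (n.choose s : ℚ)) * r ≤ ∑ s ∈ Finset.Ioo q p, ((n + 1).choose s : ℚ) := by
    rw [Finset.sum_mul]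
    refine Finset.sum_le_sum (fun s hs => ?_)
    have hsq : q < s := (Finset.mem_Ioo.1 hs).1
    exact mul_le_choose_succ n s q hsq hq
  calc c * ∑ j ∈ Finset.range (q + 1), ((n + 1).choose j : ℚ) * (w j : ℚ)
      ≤ c * ((∑ j ∈ Finset.range (q + 1), (n.choose j : ℚ) * (w j : ℚ)) * r) := mul_le_mul_of_nonneg_left hA hc
    _ = (c * ∑ j ∈ Finset.range (q + 1), (n.choose j : ℚ) * (w j : ℚ)) * r := by ring
    _ ≤ (∑ s ∈ Finset.Ioo q p, (n.choose s : ℚ)) * r := mul_le_mul_of_nonneg_right h hr0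
    _ ≤ ∑ s ∈ Finset.Ioo q p, ((n + 1).choose s : ℚ) := hY

/-- **ONE BASE VALUE CLOSES THE TAIL**: the size key at `n₀ > q` holds at every `n ≥ n₀`. -/
theorem size_key_of_base (p q n₀ : ℕ) (w : ℕ → ℕ) (c : ℚ) (hc : 0 ≤ c) (hq : q < n₀)
    (h0 : c * ∑ j ∈ Finset.range (q + 1), (n₀.choose j : ℚ) * (w j : ℚ) ≤ ∑ s ∈ Finset.Ioo q p, (n₀.choose s : ℚ)) :
    ∀ n, n₀ ≤ n → c * ∑ j ∈ Finset.range (q + 1), (n.choose j : ℚ) * (w j : ℚ) ≤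
      ∑ s ∈ Finset.Ioo q p, (n.choose s : ℚ) := by
  intro n hn
  induction n with
  | zero =>
    have : n₀ = 0 := by omega
    subst this
    exact h0
  | succ n ih =>
    rcases Nat.lt_or_ge n n₀ with hlt | hge
    · have : n₀ = n + 1 := by omega
      subst this
      exact h0
    · exact size_key_step p q n w c hc (by omega) (ih hge)

/-- **THE SIZE KEY FROM ONE BASE VALUE ON A SUB-RANGE OF LAYERS.** A cap `#{ρ ≤ q} ≤ Σ_{j≤q} C(n, j)·w_j`,
`n ≥ n₀ > q`, `q < a`, `b < p`, and `(Φ(p, q) + 1)·Σ_{j≤q} C(n₀, j)·w_j ≤ Σ_{s=a}^{b} C(n₀, s)` give `ThmN.RLS M p q`. -/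
theorem rls_of_size_key_of_base (M : Matroid α) [M.Finite] (p q : ℕ)
    (w : ℕ → ℕ)
    (hcount : {X : Set α | X ⊆ M.E ∧ M.eRk X ≤ (q : ℕ∞)}.ncard ≤ ∑ j ∈ Finset.range (q + 1), M.E.ncard.choose j * w j)
    (n₀ : ℕ) (hq : q < n₀) (hn : n₀ ≤ M.E.ncard) (a b : ℕ) (hqa : q < a) (hbp : b < p)
    (h0 : (phiK p q + 1) * ∑ j ∈ Finset.range (q + 1), (n₀.choose j : ℚ) * (w j : ℚ) ≤
      ∑ s ∈ Finset.Icc a b, (n₀.choose s : ℚ)) :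
    ThmN.RLS M p q := by
  have hΦ : 0 ≤ phiK p q + 1 := by linarith [phiK_nonneg p q]
  have hsub : Finset.Icc a b ⊆ Finset.Ioo q p := by
    intro s hs
    rw [Finset.mem_Icc] at hs
    rw [Finset.mem_Ioo]
    omega
  have h0' : (phiK p q + 1) * ∑ j ∈ Finset.range (q + 1), (n₀.choose j : ℚ) * (w j : ℚ) ≤
      ∑ s ∈ Finset.Ioo q p, (n₀.choose s : ℚ) :=
    h0.trans (Finset.sum_le_sum_of_subset_of_nonneg hsub (fun _ _ _ => Nat.cast_nonneg _))
  have hall := size_key_of_base p q n₀ w (phiK p q + 1) hΦ hq h0' M.E.ncard hn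
  have hcap : ({X : Set α | X ⊆ M.E ∧ M.eRk X ≤ (q : ℕ∞)}.ncard : ℚ) ≤
      ∑ j ∈ Finset.range (q + 1), (M.E.ncard.choose j : ℚ) * (w j : ℚ) := by
    exact_mod_cast hcount
  exact rls_of_size_key M p q _ hcap hall

end HypKey

end PercRepro
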